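import Literature.AlgebraicGeometry.Modules.PullbackFrame
import Literature.AlgebraicGeometry.Modules.FrameMatrixEnd
import HarnessLib

/-!
# Restricting frames: extensionality, composition, pull-back and matrix endomorphisms

Small API around Mathlib's restriction of a trivialisation `e : 𝒪^I ≅ E|_W` to an open `V ≤ W`
(`SheafOfModules.restrictTrivialisation`), needed to refine framed Čech cochains of `𝓔nd(E)`
(`Modules/CechEndCochain.lean`) to smaller covers:

* `frame_ext` — two frames of `E|_W` with the same basis sections are equal;
* `restrictTrivialisation_id` / `restrictTrivialisation_restrictTrivialisation` — restriction of
  frames is functorial;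
* `pullbackFrame_restrictTrivialisation` — **pulling back commutes with restricting frames**:
  `f^*(e|_V) = (f^*e)|_{f⁻¹V}` (`Modules/PullbackFrame.lean`);
* `matrixEnd_restrictTrivialisation` — the endomorphism with matrix `A` in a restricted frame is the
  endomorphism with matrix `A` in the original frame (`Modules/FrameMatrixEnd.lean`).

Everything is proved; no named facts.

## References

* R. Hartshorne, *Algebraic Geometry*, GTM 52 (1977), II.5 (pp. 109–110). [Hartshorne1977]
-/

noncomputable section

open CategoryTheory AlgebraicGeometry Opposite TopologicalSpace Limits

namespace Literature.AlgebraicGeometry.Modules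

open Literature.AlgebraicGeometry.Motives

universe u

variable {X Y : Scheme.{u}} {E : X.Modules} {W V V' : X.Opens} {I : Type u}

/-! ### Extensionality and functoriality of restriction of frames -/

/-- **Two frames of `E|_W` with the same basis sections are equal.** [folklore] -/
theorem frame_ext {e e' : SheafOfModules.free I ≅ E.over W} (h : ∀ l, basisSection e l = basisSection e' l) :
    e = e' :=
  Iso.ext ((E.over W).freeHomEquiv.injective (funext fun l =>
    (Scheme.Modules.overSectionsEquiv E W).injective (h l)))

/-- Restricting a frame along the identity does nothing. [folklore] -/
theorem restrictTrivialisation_id (e : SheafOfModules.free I ≅ E.over W) :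
    SheafOfModules.restrictTrivialisation (R := X.ringCatSheaf) (𝟙 W) e = e :=
  frame_ext fun l => by
    rw [basisSection_restrictTrivialisation, op_id, E.presheaf.map_id]
    rfl

/-- Restricting a restricted frame is restricting along the composite. [folklore] -/
theorem restrictTrivialisation_restrictTrivialisation (k : V ⟶ W) (l : V' ⟶ V)
    (e : SheafOfModules.free I ≅ E.over W) :
    SheafOfModules.restrictTrivialisation (R := X.ringCatSheaf) l
        (SheafOfModules.restrictTrivialisation (R := X.ringCatSheaf) k e) =
      SheafOfModules.restrictTrivialisation (R := X.ringCatSheaf) (l ≫ k) e :=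
  frame_ext fun m => by
    rw [basisSection_restrictTrivialisation, basisSection_restrictTrivialisation,
      basisSection_restrictTrivialisation, presheaf_map_map]

/-- Restriction of frames does not depend on the name of the inclusion. [folklore] -/
theorem restrictTrivialisation_congr (k k' : V ⟶ W) (e : SheafOfModules.free I ≅ E.over W) :
    SheafOfModules.restrictTrivialisation (R := X.ringCatSheaf) k e =
      SheafOfModules.restrictTrivialisation (R := X.ringCatSheaf) k' e := by
  rw [Subsingleton.elim k k']

/-! ### Pull-back commutes with restriction of frames -/

/-- **`f^*(e|_V) = (f^*e)|_{f⁻¹V}`**: the pulled-back frame of a restricted frame is the restricted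
pulled-back frame (both have basis sections `η(b_l|_V) = η(b_l)|_{f⁻¹V}`).
[cite: Hartshorne1977, II.5 (p. 110)] -/
theorem pullbackFrame_restrictTrivialisation (f : X ⟶ Y) {M : Y.Modules} {U U' : Y.Opens} {J : Type u}
    [Fintype J] (k : U' ⟶ U) (e : SheafOfModules.free J ≅ M.over U) :
    pullbackFrame f (SheafOfModules.restrictTrivialisation (R := Y.ringCatSheaf) k e) =
      SheafOfModules.restrictTrivialisation (R := X.ringCatSheaf) ((Opens.map f.base).map k)
        (pullbackFrame f e) :=
  frame_ext fun l => by
    rw [basisSection_pullbackFrame, basisSection_restrictTrivialisation, basisSection_restrictTrivialisation,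
      basisSection_pullbackFrame, unitSection_map]

/-! ### Matrix endomorphisms in a restricted frame -/

variable [Fintype I]

/-- **The endomorphism with matrix `A` in the restricted frame `e|_V` is the endomorphism with matrix
`A` in `e`.** [cite: Hartshorne1977, II.5 (p. 109)] -/
theorem matrixEnd_restrictTrivialisation (e : SheafOfModules.free I ≅ E.over W) (k : V ⟶ W) (k' : V' ⟶ V)
    (A : Matrix I I Γ(X, V')) :
    matrixEnd (SheafOfModules.restrictTrivialisation (R := X.ringCatSheaf) k e) k' A = matrixEnd e (k' ≫ k) A := by
  refine hom_ext_of_appLE fun V'' l s => ext_of_coordVec e (l ≫ k' ≫ k) ?_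
  have hc : ∀ t : Γ(E, V''), coordVec (SheafOfModules.restrictTrivialisation (R := X.ringCatSheaf) k e) (l ≫ k') t =
      coordVec e (l ≫ k' ≫ k) t := fun t => funext fun m => by
    rw [coordVec_apply, coordVec_apply, coord_restrictTrivialisation, Category.assoc]
  rw [← hc (appLE _ l s), coordVec_appLE_matrixEnd, hc s, coordVec_appLE_matrixEnd]

end Literature.AlgebraicGeometry.Modules

end
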